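import Mathlib
import Summits.KontsevichZagierPeriods.KontsevichZagierPeriods.Theorems.SoloInformedKZStokesCube
import Literature.NumberTheory.Transcendental.KZRulesAssociator
import HarnessLib

/-!
# SoloInformed — Green's theorem on the unit square inside the KZ calculus (toolkit for (HT))

File I2a of the (HT) step of the solo-informed programme.  For real functions `P`, `Q` which are
`ℚ`-semialgebraic and `C¹` on an open neighbourhood of the square `[0,1]²` (coordinates `s = z₀`,
`t = z₁`) and satisfy the closedness condition `∂P/∂t = ∂Q/∂s` on the square, the boundary
integral of the 1-form `P ds + Q dt` vanishes *inside the Kontsevich–Zagier calculus*: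

  `[[0,1], P(·,0)] + [[0,1], Q(1,·)] − [[0,1], P(·,1)] − [[0,1], Q(0,·)] ∈ KZ.relations`

(`soloInformed_kzGreen`; bottom + right − top − left).  Proof: Ayoub's Stokes generators
`[∂₁P] − [P|_{t=1}] + [P|_{t=0}]` and `[∂₀Q] − [Q|_{s=1}] + [Q|_{s=0}]` are KZ relations
(`soloInformed_kzStokes_cube`, each one change of variables + one Newton–Leibniz move + integrand
additivity), and the two two-dimensional representations `[∂₁P]`, `[∂₀Q]` may be taken to be the
same representation by closedness.  No primitive of the form is needed — this is what makes the
lemma usable for the pull-backs of holomorphic 1-forms along Nash 2-cells on a curve, whose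
primitives take transcendental values at the vertices.

References: Kontsevich–Zagier 2001, §1.2; Ayoub 2014, §2.2; Huber–Wüstholz 2022, Ch. 13.
-/

noncomputable section

open Set MeasureTheory
open Literature.NumberTheory.Transcendental Literature.NumberTheory.Transcendental.KZ
open Literature.ModelTheory.ExponentialFields (IsSemialgebraic)

namespace Summit.KontsevichZagierPeriods.KontsevichZagierPeriods.Theorems

/-- **Green's theorem on `[0,1]²` inside the KZ calculus.**  `P`, `Q` real, `ℚ`-semialgebraic and
`C¹` on an open `W ⊇ [0,1]²`, closed (`∂₁P = ∂₀Q` on the square); `rB, rT, rL, rR` the edge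
representations on `[0,1]` with integrands `P(s,0)`, `P(s,1)`, `Q(0,t)`, `Q(1,t)`.  Then
`[rB] + [rR] − [rT] − [rL] ∈ KZ.relations`. [Kontsevich–Zagier 2001, §1.2; Ayoub 2014, §2.2] -/
theorem soloInformed_kzGreen {W : Set (Fin 2 → ℝ)} (hW : IsOpen W) (hCW : soloInformedCube 2 ⊆ W)
    {P Q : (Fin 2 → ℝ) → ℝ} (hPs : IsSemialgebraicFunOn ℚ W P) (hQs : IsSemialgebraicFunOn ℚ W Q)
    (hPd : ContDiffOn ℝ 1 P W) (hQd : ContDiffOn ℝ 1 Q W)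
    (hclosed : ∀ z ∈ soloInformedCube 2,
      fderiv ℝ P z (Pi.single 1 1) = fderiv ℝ Q z (Pi.single 0 1))
    (rB rT rL rR : IntegralRep 1) (hBd : rB.domain = soloInformedCube 1)
    (hTd : rT.domain = soloInformedCube 1) (hLd : rL.domain = soloInformedCube 1)
    (hRd : rR.domain = soloInformedCube 1)
    (hBi : EqOn rB.integrand (fun s => P (Fin.insertNth 1 0 s)) (soloInformedCube 1))
    (hTi : EqOn rT.integrand (fun s => P (Fin.insertNth 1 1 s)) (soloInformedCube 1))
    (hLi : EqOn rL.integrand (fun t => Q (Fin.insertNth 0 0 t)) (soloInformedCube 1))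
    (hRi : EqOn rR.integrand (fun t => Q (Fin.insertNth 0 1 t)) (soloInformedCube 1)) :
    of rB + of rR - of rT - of rL ∈ relations := by
  have hC := isSemialgebraic_soloInformedCube 2
  have hd : ∀ z ∈ W, DifferentiableAt ℝ P z := fun z hz =>
    (hPd.differentiableOn one_ne_zero z hz).differentiableAt (hW.mem_nhds hz)
  -- the common two-dimensional representation `[[0,1]², ∂₁P] = [[0,1]², ∂₀Q]`
  have hDs : IsSemialgebraicFunOn ℚ (soloInformedCube 2)
      (fun z => fderiv ℝ P z (Pi.single 1 1)) := (hPs.fderiv_apply_single hW hd 1).mono hCW hC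
  have hDc : ContinuousOn (fun z => fderiv ℝ P z (Pi.single 1 1)) (soloInformedCube 2) :=
    ((hPd.continuousOn_fderiv_of_isOpen hW le_rfl).clm_apply continuousOn_const).mono hCW
  set rD : IntegralRep 2 := soloInformedCubeRep 2 _ hDs hDc with hrD
  have hSP : of rD - (of rT - of rB) ∈ relations :=
    soloInformed_kzStokes_cube hW hCW hPs hPd 1 rD rfl (fun _ _ => rfl) rT rB hTd hBd hTi hBi
  have hSQ : of rD - (of rR - of rL) ∈ relations :=
    soloInformed_kzStokes_cube hW hCW hQs hQd 0 rD rfl (fun z hz => hclosed z hz) rR rL hRd hLd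
      hRi hLi
  have heq : of rB + of rR - of rT - of rL = (of rD - (of rT - of rB)) - (of rD - (of rR - of rL)) := by
    abel
  rw [heq]
  exact relations.sub_mem hSP hSQ

/-- **Green's theorem on `[0,1]²` in the formal period ring:** with the notation of
`soloInformed_kzGreen`, `⟦rB⟧ + ⟦rR⟧ = ⟦rT⟧ + ⟦rL⟧`. -/
theorem soloInformed_kzGreen_toFormalPeriod {W : Set (Fin 2 → ℝ)} (hW : IsOpen W)
    (hCW : soloInformedCube 2 ⊆ W) {P Q : (Fin 2 → ℝ) → ℝ} (hPs : IsSemialgebraicFunOn ℚ W P)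
    (hQs : IsSemialgebraicFunOn ℚ W Q) (hPd : ContDiffOn ℝ 1 P W) (hQd : ContDiffOn ℝ 1 Q W)
    (hclosed : ∀ z ∈ soloInformedCube 2,
      fderiv ℝ P z (Pi.single 1 1) = fderiv ℝ Q z (Pi.single 0 1))
    (rB rT rL rR : IntegralRep 1) (hBd : rB.domain = soloInformedCube 1)
    (hTd : rT.domain = soloInformedCube 1) (hLd : rL.domain = soloInformedCube 1)
    (hRd : rR.domain = soloInformedCube 1)
    (hBi : EqOn rB.integrand (fun s => P (Fin.insertNth 1 0 s)) (soloInformedCube 1))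
    (hTi : EqOn rT.integrand (fun s => P (Fin.insertNth 1 1 s)) (soloInformedCube 1))
    (hLi : EqOn rL.integrand (fun t => Q (Fin.insertNth 0 0 t)) (soloInformedCube 1))
    (hRi : EqOn rR.integrand (fun t => Q (Fin.insertNth 0 1 t)) (soloInformedCube 1)) :
    toFormalPeriod (of rB) + toFormalPeriod (of rR) =
      toFormalPeriod (of rT) + toFormalPeriod (of rL) := by
  rw [← map_add, ← map_add, toFormalPeriod_eq_iff]
  have heq : of rB + of rR - (of rT + of rL) = of rB + of rR - of rT - of rL := by abel
  rw [heq]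
  exact soloInformed_kzGreen hW hCW hPs hQs hPd hQd hclosed rB rT rL rR hBd hTd hLd hRd hBi hTi
    hLi hRi

/-! ### Coordinates on the square

For the applications: the edge points in the spelling `Fin.insertNth`. -/

/-- Bottom edge point: `insertNth 1 0 s = (s₀, 0)`. -/
theorem soloInformed_insertNth_one_apply_zero (c : ℝ) (s : Fin 1 → ℝ) :
    (Fin.insertNth 1 c s : Fin 2 → ℝ) 0 = s 0 := by
  have h : (0 : Fin 2) = (1 : Fin 2).succAbove 0 := by decide
  rw [h, Fin.insertNth_apply_succAbove]

/-- Bottom/top edge point: second coordinate of `insertNth 1 c s` is `c`. -/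
theorem soloInformed_insertNth_one_apply_one (c : ℝ) (s : Fin 1 → ℝ) :
    (Fin.insertNth 1 c s : Fin 2 → ℝ) 1 = c := by
  simp

/-- Left/right edge point: first coordinate of `insertNth 0 c t` is `c`. -/
theorem soloInformed_insertNth_zero_apply_zero (c : ℝ) (t : Fin 1 → ℝ) :
    (Fin.insertNth 0 c t : Fin 2 → ℝ) 0 = c := by
  simp

/-- Left/right edge point: `insertNth 0 c t = (c, t₀)`. -/
theorem soloInformed_insertNth_zero_apply_one (c : ℝ) (t : Fin 1 → ℝ) :
    (Fin.insertNth 0 c t : Fin 2 → ℝ) 1 = t 0 := by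
  have h : (1 : Fin 2) = (0 : Fin 2).succAbove 0 := by decide
  rw [h, Fin.insertNth_apply_succAbove]

end Summit.KontsevichZagierPeriods.KontsevichZagierPeriods.Theorems
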